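import Mathlib
import Literature.Barriers.ValiantsHypothesis.AlgebraicNaturalProofs
import Summits.ValiantsHypothesis.ValiantsHypothesis.Theorems.BarrierLeverSuccinctHittingSetsForVPCoordSlice
import Summits.ValiantsHypothesis.ValiantsHypothesis.Theorems.BarrierLeverSuccinctHittingSetsForVPSetMultilinearSlice
import Summits.ValiantsHypothesis.ValiantsHypothesis.Theorems.BarrierLeverDefinableEquationsSparsityWallTwo
import HarnessLib

/-!
# Crux `BarrierLever.SuccinctHittingSetsForVP` (stmt-ValiantsHypothesis-14610) — COORDINATE SLICES AT
# SIZE EXPONENT 2: sparse distinguishers are hit RELATIVE TO any coordinate slice with a CHEAP indicator,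
# already by `SmallCircuits ℂ n 2` (val-np-p5 g16)

`…CoordSlice.lean` (planner p1 / FSV Thm. 9's mechanism): if a coordinate slice `coordSlice good`
contains an indicator `f₁ ∈ SmallCircuits ℂ n 2` (support = the good monomials of degree `≤ n`,
coefficients `1`), then for `n ≥ 8a + 2` every `N^a`-sparse distinguisher nonzero somewhere on the
slice is nonzero at a member of `SmallCircuits ℂ n 3 ∩ slice`.  The exponent `3` came from charging
the `≤ 2an` free monomials `2n + 2` gates each.  With the AMORTISED budget of `…SparsityWallTwo.lean`
(`SparsityWall.shift_mem_of_batch`, `SparsityWall.budget_two`: `2an` free monomials of degree `≤ n`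
plus a base of size `≤ 2n + 1` fit into `n²`, eventually in `n`) the same proof gives exponent `2`
whenever the indicator is LINEAR-size:

* `isSuccinctHittingSetRel_coordSlice_sparse_two` — indicator `f₁` of degree `≤ n` and size
  `≤ 2n + 1` ⇒ for `n ≥ n₀(a)` the slice-relative hitting set is `SmallCircuits ℂ n 2 ∩ slice`;
* `isSuccinctHittingSetRel_multilinear_sparse_two` — the multilinear slice (`f₁ = ∏ (1 + x_i)`, size
  `≤ 2n`): for every `a`, eventually in `n`, for every `b ≥ 2`, every `N^a`-sparse polynomial nonzero
  at some multilinear coefficient vector is nonzero at a MULTILINEAR member of `SmallCircuits ℂ n b`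
  (tree: `b = 3`, `isSuccinctHittingSetRel_multilinear_sparse`);
* `not_naturalProofRel_multilinear_sparse_two` — hence no `N^a`-sparse distinguisher is a
  multilinear-relative natural proof against size `n^b`, `b ≥ 2` (e.g. for the permanent's slice);
* `setMultilinear_sparse_two`, `not_naturalProofRel_setMultilinear_sparse_two` — the same for every
  set-multilinear slice (indicator = block product, size `≤ n + d`; tree: `b = 3`, `setMultilinear_sparse`).

WHAT THIS IS NOT: nothing on the dense case of the crux (`stub_dense`, OPEN) or on `VP ≠ VNP`.  No
definitions, no named facts; standard axioms.  Refs: [ForbesShpilkaVolk2018] §1.2, Thm. 9, Lemma 32,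
Cor. 34; Bürgisser 2000 Rem. 2.7.
-/

-- layout Summits/ValiantsHypothesis/ValiantsHypothesis forces the duplicated namespace component
set_option linter.dupNamespace false

noncomputable section

namespace Summit.ValiantsHypothesis.ValiantsHypothesis.Theorems.BarrierLever.SuccinctHittingSetsForVP

namespace CoordSlice

open Literature.Barriers.ValiantsHypothesis Literature.Computability.AlgebraicComplexity MvPolynomial
open Summit.ValiantsHypothesis.ValiantsHypothesis.Theorems.BarrierLever.SuccinctHittingSetsForVP.MultilinearSparseGlue
open Summit.ValiantsHypothesis.ValiantsHypothesis.Theorems.BarrierLeverDefinableEquations.SparsityWall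
  (batchBudget batchBudget_mono shift_mem_of_batch budget_two levels blockSize)

variable {n : ℕ}

/-- **Coordinate-slice theorem at exponent 2.**  Let `good` be any monomial predicate and `f₁` an
indicator of the slice (supported on good monomials, coefficient `1` at every good monomial of degree
`≤ n`) of degree `≤ n` and LINEAR size `≤ 2n + 1`.  Then for `n ≥ n₀(a)` (the threshold of
`SparsityWall.budget_two`) every `C(2n,n)^a`-sparse polynomial nonzero somewhere on `coordSlice good`
is nonzero at a member of `SmallCircuits ℂ n 2 ∩ coordSlice good` — the `2an` free monomials of FSV's
shift are paid for by the amortised budget. [cite: ForbesShpilkaVolk2018, Thm. 9 and Lemma 32] -/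
theorem isSuccinctHittingSetRel_coordSlice_sparse_two {n a : ℕ}
    (hn : 4 * (2 ^ blockSize a + 2 * a * (3 * levels a + 2) + 3) + blockSize a * 2 ^ blockSize a ≤ n)
    (good : (Fin n →₀ ℕ) → Prop) (f₁ : MvPolynomial (Fin n) ℂ) (hf₁deg : f₁.totalDegree ≤ n)
    (hf₁L : complexity f₁ ≤ 2 * n + 1) (hf₁P : f₁ ∈ coordSlice good)
    (hcoef₁ : ∀ μ : degLEMonomials n, good μ → coeff (μ : Fin n →₀ ℕ) f₁ = 1) :
    IsSuccinctHittingSetRel (degLEMonomials n) (coordSlice good) (SmallCircuits ℂ n 2)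
      {D | D.support.card ≤ Nat.choose (2 * n) n ^ a} := by
  classical
  rintro D hD ⟨g, hg, hgne⟩
  have hDa : D.support.card ≤ Nat.choose (2 * n) n ^ a := hD
  haveI : Fintype (degLEMonomials n) := (MultilinearCoords.finite_degLEMonomials n).fintype
  obtain ⟨T, hT⟩ : ∃ T : Finset (degLEMonomials n), ∀ μ : degLEMonomials n, μ ∈ T ↔ good μ :=
    ⟨Finset.univ.filter fun μ : degLEMonomials n => good μ, fun μ => by
      simp only [Finset.mem_filter, Finset.mem_univ, true_and]⟩
  -- Step 1: killing the bad coordinates leaves `D` nonzero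
  have hρ0 : aeval (fun μ => if μ ∈ T then (X μ : MvPolynomial (degLEMonomials n) ℂ) else 0) D ≠ 0 := by
    intro h0
    apply hgne
    rw [← eval_subst_of_mem_coordSlice hT hg D, h0, map_zero]
  -- Step 2: transport to the polynomial ring on the good coordinates
  obtain ⟨E, hE⟩ := exists_rename_eq_subst T D
  have hE0 : E ≠ 0 := by
    rintro rfl
    exact hρ0 (by rw [← hE, map_zero])
  have hEcard : E.support.card ≤ 2 ^ (2 * a * n) := by
    rw [← card_support_rename_val T E, hE]
    exact (card_support_subst_le T D).trans (hDa.trans SparseGlue.choose_pow_le)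
  -- Step 3: FSV Lemma 32 with the all-ones shift: a narrow monomial `m`
  obtain ⟨m, hm, hmcard⟩ :
      ∃ m ∈ (aeval (fun i : ↥T => C (1 : ℂ) + X i) E).support,
        2 ^ m.support.card ≤ E.support.card :=
    ShiftSmallSupport.exists_narrow_monomial (fun _ => (1 : ℂ))
      (fun S H hH => stub_prodSparsity _ S (fun _ => (1 : ℂ)) (fun _ _ => one_ne_zero) H hH) hE0
  have hmt : m.support.card ≤ 2 * a * n :=
    (Nat.pow_le_pow_iff_right (by norm_num)).mp (hmcard.trans hEcard)
  -- Step 4: a non-root `1 + w` of `E` with `w` supported on `supp m`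
  obtain ⟨w, hw, hne⟩ := LowSupport.exists_eval_ne_zero_supported hm
  have hne' : eval (fun i => (1 : ℂ) + w i) E ≠ 0 := by
    rwa [ShiftedSupport.eval_shift] at hne
  -- Step 5: the hitting polynomial `f₁ + Σ_{ν ∈ supp m} w_ν x^ν` inside the slice, AMORTISED
  obtain ⟨W, hWdef⟩ : ∃ W : degLEMonomials n → ℂ,
      W = fun μ => if h : μ ∈ T then w ⟨μ, h⟩ else 0 := ⟨_, rfl⟩
  have hWval : ∀ i : ↥T, W (i : degLEMonomials n) = w i := by
    intro i
    rw [hWdef]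
    dsimp only
    rw [dif_pos i.2]
  have hST : ∀ μ ∈ m.support.image Subtype.val, μ ∈ T := by
    intro μ hμ
    obtain ⟨i, -, rfl⟩ := Finset.mem_image.mp hμ
    exact i.2
  have hW : ∀ μ, μ ∉ m.support.image Subtype.val → W μ = 0 := by
    intro μ hμ
    rw [hWdef]
    dsimp only
    split_ifs with h
    · exact hw ⟨μ, h⟩ fun hmem => hμ (Finset.mem_image.mpr ⟨⟨μ, h⟩, hmem, rfl⟩)
    · rfl
  have hScard : (m.support.image Subtype.val).card ≤ 2 * a * n :=
    Finset.card_image_le.trans hmt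
  have hfP : f₁ + ∑ μ ∈ m.support.image Subtype.val, monomial (μ : Fin n →₀ ℕ) (W μ) ∈
      coordSlice good :=
    add_sparse_mem_coordSlice hf₁P _ (fun μ hμ => (hT μ).mp (hST μ hμ)) W
  have hr : 0 < blockSize a := by unfold blockSize; omega
  obtain ⟨hdeg, hsize⟩ := shift_mem_of_batch (k := levels a) hr hf₁deg hf₁L
    (m.support.image Subtype.val) W
  have hmem : f₁ + ∑ μ ∈ m.support.image Subtype.val, monomial (μ : Fin n →₀ ℕ) (W μ) ∈
      SmallCircuits ℂ n 2 :=
    ⟨hdeg, hsize.trans ((Nat.add_le_add_left (batchBudget_mono hScard) _).trans (budget_two a hn))⟩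
  refine ⟨f₁ + ∑ μ ∈ m.support.image Subtype.val, monomial (μ : Fin n →₀ ℕ) (W μ), hmem, hfP, ?_⟩
  rw [← eval_subst_of_mem_coordSlice hT hfP D, ← hE, eval_rename,
    ShiftedSupport.coeffVector_shift f₁ _ hW]
  have hfun : ((fun μ : degLEMonomials n => coeff (μ : Fin n →₀ ℕ) f₁ + W μ) ∘
      (Subtype.val : ↥T → degLEMonomials n)) = fun i : ↥T => 1 + w i := by
    funext i
    rw [Function.comp_apply, hcoef₁ _ ((hT _).mp i.2), hWval]
  rw [hfun]
  exact hne'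

/-- `∏_i (1 + x_i)` has size `≤ 2n` (each factor one gate, `n` products). [cite: Burgisser2000, §2.1] -/
theorem complexity_prod_one_add_X_le_two_mul :
    complexity (∏ i : Fin n, (1 + X i) : MvPolynomial (Fin n) ℂ) ≤ 2 * n := by
  have hfac : ∀ i : Fin n, complexity (1 + X i : MvPolynomial (Fin n) ℂ) ≤ 1 := fun i => by
    have h := complexity_add_le_holds (1 : MvPolynomial (Fin n) ℂ) (X i)
    have h1 : complexity (1 : MvPolynomial (Fin n) ℂ) = 0 := by
      simpa using complexity_C_holds (σ := Fin n) (1 : ℂ)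
    rw [h1, complexity_X_holds] at h
    omega
  calc complexity (∏ i : Fin n, (1 + X i) : MvPolynomial (Fin n) ℂ)
      ≤ ∑ i : Fin n, complexity (1 + X i : MvPolynomial (Fin n) ℂ) + (Finset.univ : Finset (Fin n)).card :=
        complexity_finset_prod_le _ _
    _ ≤ ∑ _i : Fin n, 1 + (Finset.univ : Finset (Fin n)).card := by gcongr with i; exact hfac i
    _ = 2 * n := by simp; ring

/-- **Sparse distinguishers are hit relative to the multilinear slice, at exponent 2.**  For every
`a` there is `n₀` such that for all `n ≥ n₀` and every `b ≥ 2`, every `C(2n,n)^a`-sparse polynomial in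
the coefficient variables that is nonzero at the coefficient vector of SOME multilinear polynomial is
nonzero at the coefficient vector of a MULTILINEAR polynomial of degree `≤ n` and size `≤ n^b` (tree:
`b = 3`). [cite: ForbesShpilkaVolk2018, Thm. 9 and Cor. 34] -/
theorem isSuccinctHittingSetRel_multilinear_sparse_two :
    ∀ a : ℕ, ∃ n₀ : ℕ, ∀ n : ℕ, n₀ ≤ n → ∀ b : ℕ, 2 ≤ b →
      IsSuccinctHittingSetRel (degLEMonomials n) (multilinearSlice ℂ n) (SmallCircuits ℂ n b)
        {D : MvPolynomial (degLEMonomials n) ℂ | D.support.card ≤ Nat.choose (2 * n) n ^ a} := by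
  intro a
  refine ⟨4 * (2 ^ blockSize a + 2 * a * (3 * levels a + 2) + 3) + blockSize a * 2 ^ blockSize a,
    fun n hn b hb => ?_⟩
  have hn1 : 1 ≤ n := Nat.succ_le_of_lt (lt_of_lt_of_le (by positivity) hn)
  have hn2 : 2 ≤ n := by
    have h3 : 2 ≤ 2 ^ blockSize a + 2 * a * (3 * levels a + 2) + 3 := le_add_left (by norm_num)
    have h4 : 2 ≤ 4 * (2 ^ blockSize a + 2 * a * (3 * levels a + 2) + 3) :=
      h3.trans (Nat.le_mul_of_pos_left _ (by norm_num))
    exact h4.trans ((Nat.le_add_right _ _).trans hn)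
  obtain ⟨-, hml, hcoef⟩ := stub_multilinearBase n hn2
  have h2 : IsSuccinctHittingSetRel (degLEMonomials n) (multilinearSlice ℂ n) (SmallCircuits ℂ n 2)
      {D : MvPolynomial (degLEMonomials n) ℂ | D.support.card ≤ Nat.choose (2 * n) n ^ a} := by
    rw [multilinearSlice_eq_coordSlice]
    refine isSuccinctHittingSetRel_coordSlice_sparse_two hn _ _ MultilinearBase.totalDegree_prod_one_add_X_le
      (complexity_prod_one_add_X_le_two_mul.trans (Nat.le_succ _)) hml fun μ hμ => ?_
    rw [hcoef, if_pos hμ]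
  rintro D hD ⟨g, hg, hgne⟩
  obtain ⟨f, hf, hfP, hfne⟩ := h2 D hD ⟨g, hg, hgne⟩
  exact ⟨f, smallCircuits_mono ℂ hb hn1 hf, hfP, hfne⟩

/-- **No sparse multilinear-relative natural proofs against size `n²`.**  For every `a`, eventually
in `n`, for every `b ≥ 2`: an `N^a`-sparse polynomial vanishing at the coefficient vectors of all
MULTILINEAR members of `SmallCircuits ℂ n b` vanishes at the coefficient vector of every multilinear
polynomial — it certifies nothing about a multilinear target such as the permanent (tree: `b ≥ 3`,
`not_naturalProofRel_multilinear_sparse`). [cite: ForbesShpilkaVolk2018, Def. 1 and Thm. 9] -/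
theorem not_naturalProofRel_multilinear_sparse_two (a : ℕ) : ∃ n₀ : ℕ, ∀ n : ℕ, n₀ ≤ n →
    ∀ b : ℕ, 2 ≤ b → ∀ D : MvPolynomial (degLEMonomials n) ℂ,
      D.support.card ≤ Nat.choose (2 * n) n ^ a →
      (∀ f ∈ SmallCircuits ℂ n b, f ∈ multilinearSlice ℂ n →
        eval (coeffVector (degLEMonomials n) f) D = 0) →
      ∀ g ∈ multilinearSlice ℂ n, eval (coeffVector (degLEMonomials n) g) D = 0 := by
  obtain ⟨n₀, h⟩ := isSuccinctHittingSetRel_multilinear_sparse_two a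
  refine ⟨n₀, fun n hn b hb D hsparse hvan g hg => ?_⟩
  by_contra hne
  obtain ⟨f, hf, hfml, hfne⟩ := h n hn b hb D hsparse ⟨g, hg, hne⟩
  exact hfne (hvan f hf hfml)

/-- **Set-multilinear slices at exponent 2.**  For every `a` there is `n₀` such that for all
`n ≥ n₀`, every `b ≥ 2` and EVERY block labelling `π : Fin n → Fin d`, every `C(2n,n)^a`-sparse
polynomial nonzero somewhere on the set-multilinear slice of `π` is nonzero at a set-multilinear
member of `SmallCircuits ℂ n b` (indicator: the block product `∏_j Σ_{π i = j} x_i`, size `≤ n + d`;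
tree: `b = 3`, `setMultilinear_sparse`). [cite: ForbesShpilkaVolk2018, Thm. 9] -/
theorem setMultilinear_sparse_two :
    ∀ a : ℕ, ∃ n₀ : ℕ, ∀ n : ℕ, n₀ ≤ n → ∀ b : ℕ, 2 ≤ b → ∀ (d : ℕ) (π : Fin n → Fin d),
      IsSuccinctHittingSetRel (degLEMonomials n) (setMultilinearSlice π) (SmallCircuits ℂ n b)
        {D : MvPolynomial (degLEMonomials n) ℂ | D.support.card ≤ Nat.choose (2 * n) n ^ a} := by
  intro a
  refine ⟨4 * (2 ^ blockSize a + 2 * a * (3 * levels a + 2) + 3) + blockSize a * 2 ^ blockSize a,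
    fun n hn b hb d π => ?_⟩
  have hn1 : 1 ≤ n := Nat.succ_le_of_lt (lt_of_lt_of_le (by positivity) hn)
  have hn2 : 2 ≤ n := by
    have h3 : 2 ≤ 2 ^ blockSize a + 2 * a * (3 * levels a + 2) + 3 := le_add_left (by norm_num)
    have h4 : 2 ≤ 4 * (2 ^ blockSize a + 2 * a * (3 * levels a + 2) + 3) :=
      h3.trans (Nat.le_mul_of_pos_left _ (by norm_num))
    exact h4.trans ((Nat.le_add_right _ _).trans hn)
  obtain ⟨-, hP, hcoef⟩ := setMultilinearBase_holds n d π hn2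
  have hbase : (blockProd π).totalDegree ≤ n ∧ complexity (blockProd π) ≤ 2 * n + 1 := by
    by_cases hd : d ≤ n
    · exact ⟨(totalDegree_blockProd_le π).trans hd, (complexity_blockProd_le π).trans (by omega)⟩
    · rw [blockProd_eq_zero_of_lt π (by omega)]
      refine ⟨by simp, ?_⟩
      rw [← C_0, complexity_C_holds]
      exact Nat.zero_le _
  have h2 : IsSuccinctHittingSetRel (degLEMonomials n) (setMultilinearSlice π) (SmallCircuits ℂ n 2)
      {D : MvPolynomial (degLEMonomials n) ℂ | D.support.card ≤ Nat.choose (2 * n) n ^ a} :=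
    isSuccinctHittingSetRel_coordSlice_sparse_two hn _ _ hbase.1 hbase.2 hP fun μ hμ => hcoef _ hμ
  rintro D hD ⟨g, hg, hgne⟩
  obtain ⟨f, hf, hfP, hfne⟩ := h2 D hD ⟨g, hg, hgne⟩
  exact ⟨f, smallCircuits_mono ℂ hb hn1 hf, hfP, hfne⟩

/-- **No sparse set-multilinear-relative natural proofs against size `n²`** (tree: `b ≥ 3`): for
every `a`, eventually in `n`, for every `b ≥ 2`, every block labelling and every target, an
`N^a`-sparse polynomial vanishing at all SET-MULTILINEAR members of `SmallCircuits ℂ n b` vanishes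
on the whole set-multilinear slice (so certifies nothing about `IMM` or a set-multilinear encoding of
the permanent). [cite: ForbesShpilkaVolk2018, Def. 1 and Thm. 9] -/
theorem not_naturalProofRel_setMultilinear_sparse_two (a : ℕ) : ∃ n₀ : ℕ, ∀ n : ℕ, n₀ ≤ n →
    ∀ b : ℕ, 2 ≤ b → ∀ (d : ℕ) (π : Fin n → Fin d) (D : MvPolynomial (degLEMonomials n) ℂ),
      D.support.card ≤ Nat.choose (2 * n) n ^ a →
      (∀ f ∈ SmallCircuits ℂ n b, f ∈ setMultilinearSlice π →
        eval (coeffVector (degLEMonomials n) f) D = 0) →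
      ∀ g ∈ setMultilinearSlice π, eval (coeffVector (degLEMonomials n) g) D = 0 := by
  obtain ⟨n₀, h⟩ := setMultilinear_sparse_two a
  refine ⟨n₀, fun n hn b hb d π D hsparse hvan g hg => ?_⟩
  by_contra hne
  obtain ⟨f, hf, hfP, hfne⟩ := h n hn b hb d π D hsparse ⟨g, hg, hne⟩
  exact hfne (hvan f hf hfP)

end CoordSlice

end Summit.ValiantsHypothesis.ValiantsHypothesis.Theorems.BarrierLever.SuccinctHittingSetsForVP

end
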